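import Summits.CriticalPhenomena.PercolationContinuityZ3.Theorems.PercNearOneGluingNoHeavyLowerTailSunflowerTwoGenCoreBox
import Summits.CriticalPhenomena.PercolationContinuityZ3.Theorems.PercNearOneGluingNoHeavyLowerTailSunflowerKDecreasing
import Summits.CriticalPhenomena.PercolationContinuityZ3.Theorems.PercNearOneGluingNoHeavyLowerTailSunflowerPrincipalCore
import HarnessLib

/-!
# `NoHeavyLowerTail` (crux stmt-CriticalPhenomena-4575), abstract sunflower cubic: the TWO-GENERATOR-CORE THEOREM —
# Lemma A `∏_i μ(V_i) ≤ μ(A)^{K−1}` holds UNCONDITIONALLY whenever the core `A` has at most two minimal elements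

Support file (seat `prim-ineq-prove-1` gen 34; `--supports stmt-CriticalPhenomena-4575`).  No `sorry`, no named facts.  Memo:
run/shared/lean/prim/prim-ineq-prove-1/FINDING-PRINCIPALCORE-prove1-g34.md §3–§5 (the case `r ≤ 2` of the Δ-system-core theorem).
Inputs: `…SunflowerTwoGenCoreBox` (box encoding `V ⊆ Zset (suppH V) (suppB V)`, disjoint supports, law of the box event) and
`…SunflowerKDecreasing` (the K-decreasing-functions lemma `KDecreasing.prod_Ex_le_of_antitone'`).

MAIN THEOREM (`prod_real_le_real_core_pow`).  `ι` finite, `μ = prodBernoulli p`, `g₁ g₂ : Finset ι`, `A = {ω | g₁ ⊆ ω} ∪ {ω | g₂ ⊆ ω}`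
(`TwoGenCore.core g₁ g₂`; `g₁ = g₂`, `g₁ ⊆ g₂` are allowed — the principal case).  For up-sets `V i` (`i` in a finite type `κ`) with
`V i ∩ V j ⊆ A` (`i ≠ j`):     `∏_i μ(V i) ≤ μ(A)^(|κ| − 1)`     — for EVERY `p`, no density hypothesis.
PROOF (memo §3): `μ(V i) ≤ μ(Zset_i) = (∏_{e∈h∖Uh_i} p e) · Σ_{T⊆a} w(T) ζ(col_i T)` (`real_Zset`; `h = g₁ ∩ g₂`, `a = g₁∖g₂`, `b = g₂∖g₁`,
`ζ(W) = ∏_{f∈b∖W} p f`); the kernel factors multiply to `≤ (∏_h p)^(K−1)` because the `Uh_i` are disjoint (`prod_prod_sdiff_le_pow`); the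
box factors are expectations, over the missing part `T` of `a`, of the ANTITONE functions `T ↦ ζ(col_i T) ∈ [∏_b p, 1]` whose product at
every `T ≠ ∅` is `≤ (∏_b p)^(K−1)` (the `col_i T` are disjoint), so the K-decreasing-functions lemma bounds their product by
`(P_a + (1−P_a)P_b)^(K−1)`; finally `μ(A) = (∏_h p)(P_a + P_b − P_aP_b)` (`real_core`).  (If `∏_b p = 0` a direct argument replaces the lemma.)
COROLLARIES (three-petal sunflowers with such a core, cells `a = μ A`, `c_i`, `b`): `lemmaA_of_twoGeneratorCore` (`μE₁ μE₂ μE₃ ≤ μ(A)²`),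
hence — exactly as in `…SunflowerPrincipalCore` — Lemma A in cells, (C1-law), the `H`/`G`/`T` rows and Kahn's Conjecture 5 on the
complements, unconditionally (`e3_le_core_mul_AG₂`, `e3_le_max_mul_AG₂`, `sahiE3_compl_nonneg_of_twoGeneratorCore`).
-/

noncomputable section

namespace Summit.CriticalPhenomena.PercolationContinuityZ3.Theorems.SunflowerPartition

namespace TwoGenCore

open MeasureTheory Finset
open Literature.Probability.LatticeModels Literature.Probability.Percolation

variable {ι : Type*} [DecidableEq ι] {κ : Type*} [Fintype κ]

/-! ## Two counting lemmas on products of probabilities -/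

/-- A product of `[0,1]`-factors over a larger set is smaller. [this work] -/
theorem prod_le_prod_of_subset {s t : Finset ι} (hst : s ⊆ t) {q : ι → ℝ} (hq : ∀ e, 0 ≤ q e ∧ q e ≤ 1) :
    ∏ e ∈ t, q e ≤ ∏ e ∈ s, q e := by
  rw [← Finset.prod_sdiff hst]
  have h1 : ∏ e ∈ t \ s, q e ≤ 1 := Finset.prod_le_one (fun e _ => (hq e).1) fun e _ => (hq e).2
  have h2 : 0 ≤ ∏ e ∈ s, q e := Finset.prod_nonneg fun e _ => (hq e).1
  nlinarith

/-- **Disjoint exceptional sets**: `∏_i ∏_{e ∈ s ∖ W i} q e ≤ (∏_{e∈s} q e)^(|κ|−1)` when the `W i` are pairwise disjoint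
(each `e` is excused at most once). [this work] -/
theorem prod_prod_sdiff_le_pow (s : Finset ι) {q : ι → ℝ} (hq : ∀ e, 0 ≤ q e ∧ q e ≤ 1) (W : κ → Finset ι)
    (hW : ∀ i j, i ≠ j → Disjoint (W i) (W j)) :
    ∏ i, ∏ e ∈ s \ W i, q e ≤ (∏ e ∈ s, q e) ^ (Fintype.card κ - 1) := by
  classical
  have step : ∀ i, ∏ e ∈ s \ W i, q e = ∏ e ∈ s, (if e ∈ W i then 1 else q e) := by
    intro i
    rw [Finset.prod_ite, Finset.prod_const_one, one_mul]
    congr 1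
    ext e; simp [Finset.mem_sdiff]
  simp_rw [step]
  rw [Finset.prod_comm, ← Finset.prod_pow]
  refine Finset.prod_le_prod (fun e _ => Finset.prod_nonneg fun i _ => by split_ifs <;> linarith [(hq e).1]) fun e _ => ?_
  rw [Finset.prod_ite, Finset.prod_const_one, one_mul, Finset.prod_const]
  have hcard : (Finset.univ.filter fun i => e ∈ W i).card ≤ 1 := by
    rw [Finset.card_le_one]
    intro i hi j hj
    rw [Finset.mem_filter] at hi hj
    by_contra hij
    exact Finset.disjoint_left.1 (hW i j hij) hi.2 hj.2
  have h2 := Finset.card_filter_add_card_filter_not (s := (Finset.univ : Finset κ)) (fun i => e ∈ W i)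
  rw [Finset.card_univ] at h2
  exact pow_le_pow_of_le_one (hq e).1 (hq e).2 (by omega)

/-- The weights `wmiss p a T`, `T ⊆ W`, followed by "everything in `a ∖ W` present", sum to `∏_{e∈a∖W} p e`. [this work] -/
theorem sum_wmiss_subset (p : ι → unitInterval) {a W : Finset ι} (hW : W ⊆ a) :
    ∑ T ∈ W.powerset, wmiss p a T = ∏ e ∈ a \ W, (p e : ℝ) := by
  have h := Finset.prod_add (fun e => 1 - (p e : ℝ)) (fun e => (p e : ℝ)) W
  simp only [sub_add_cancel, Finset.prod_const_one] at h
  have key : ∀ T ∈ W.powerset, wmiss p a T = ((∏ e ∈ T, (1 - (p e : ℝ))) * ∏ e ∈ W \ T, (p e : ℝ)) * ∏ e ∈ a \ W, (p e : ℝ) := by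
    intro T hT
    rw [Finset.mem_powerset] at hT
    unfold wmiss
    rw [mul_assoc, ← Finset.prod_union (Finset.disjoint_sdiff.mono_left Finset.sdiff_subset)]
    congr 2
    ext e
    simp only [Finset.mem_sdiff, Finset.mem_union]
    constructor
    · intro ⟨hea, heT⟩
      by_cases heW : e ∈ W
      · exact Or.inl ⟨heW, heT⟩
      · exact Or.inr ⟨hea, heW⟩
    · rintro (⟨heW, heT⟩ | ⟨hea, heW⟩)
      · exact ⟨hW heW, heT⟩
      · exact ⟨hea, fun heT => heW (hT heT)⟩
  rw [Finset.sum_congr rfl key, ← Finset.sum_mul, ← h, one_mul]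

/-! ## The box factor as an expectation over the missing part of `a` -/

section Box

variable (p : ι → unitInterval) (g₁ g₂ : Finset ι)

/-- `ζ(W) = ∏_{f ∈ b ∖ W} p f`: probability that the missing part of `b` lies in `W`. [this work] -/
def zeta (p : ι → unitInterval) (g₁ g₂ : Finset ι) (W : Finset ι) : ℝ := ∏ f ∈ (g₂ \ g₁) \ W, (p f : ℝ)

/-- `∏_b p ≤ ζ(W) ≤ 1`. [this work] -/
theorem zeta_bounds (W : Finset ι) : ∏ f ∈ g₂ \ g₁, (p f : ℝ) ≤ zeta p g₁ g₂ W ∧ zeta p g₁ g₂ W ≤ 1 := by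
  have hq : ∀ e, 0 ≤ ((p e : unitInterval) : ℝ) ∧ ((p e : unitInterval) : ℝ) ≤ 1 := fun e => ⟨(p e).2.1, (p e).2.2⟩
  exact ⟨prod_le_prod_of_subset Finset.sdiff_subset hq, Finset.prod_le_one (fun e _ => (hq e).1) fun e _ => (hq e).2⟩

/-- `ζ ∘ col` is antitone in the row set. [this work] -/
theorem zeta_col_anti (Ub : Finset (ι × ι)) {T T' : Finset ι} (hTT' : T ⊆ T') :
    zeta p g₁ g₂ (col g₁ g₂ Ub T') ≤ zeta p g₁ g₂ (col g₁ g₂ Ub T) := by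
  have hq : ∀ e, 0 ≤ ((p e : unitInterval) : ℝ) ∧ ((p e : unitInterval) : ℝ) ≤ 1 := fun e => ⟨(p e).2.1, (p e).2.2⟩
  refine prod_le_prod_of_subset (Finset.sdiff_subset_sdiff le_rfl fun f hf => ?_) hq
  rw [mem_col] at hf ⊢
  exact ⟨hf.1, fun e he => hf.2 e (hTT' he)⟩

/-- The box factor is an expectation (`KDecreasing.Ex` over the subtype of `a`) of `ζ ∘ col`. [this work] -/
theorem box_eq_Ex (Ub : Finset (ι × ι)) :
    ∑ T ∈ (g₁ \ g₂).powerset, wmiss p (g₁ \ g₂) T * zeta p g₁ g₂ (col g₁ g₂ Ub T) =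
      KDecreasing.Ex (g := ↥(g₁ \ g₂)) (fun x => (p x : ℝ))
        (fun S => zeta p g₁ g₂ (col g₁ g₂ Ub (S.map (Function.Embedding.subtype _)))) := by
  classical
  set a := g₁ \ g₂ with ha
  unfold KDecreasing.Ex
  symm
  refine Finset.sum_bij (fun S _ => S.map (Function.Embedding.subtype _)) (fun S _ => ?_) (fun S _ S' _ h => ?_) (fun T hT => ?_)
    (fun S _ => ?_)
  · rw [Finset.mem_powerset]
    intro e he
    rw [Finset.mem_map] at he
    obtain ⟨x, _, rfl⟩ := he
    exact x.2
  · exact Finset.map_injective _ h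
  · refine ⟨T.subtype (· ∈ a), Finset.mem_univ _, ?_⟩
    rw [Finset.mem_powerset] at hT
    exact Finset.subtype_map_of_mem fun x hx => hT hx
  · congr 1
    unfold KDecreasing.wt wmiss
    set T := S.map (Function.Embedding.subtype (· ∈ a)) with hT
    have hsub : T ⊆ a := by
      intro e he
      rw [hT, Finset.mem_map] at he
      obtain ⟨x, _, rfl⟩ := he
      exact x.2
    have h1 : (∏ x : ↥a, if x ∈ S then 1 - ((p x : unitInterval) : ℝ) else ((p x : unitInterval) : ℝ)) =
        ∏ e ∈ a, (if e ∈ T then 1 - (p e : ℝ) else (p e : ℝ)) := by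
      rw [← Finset.prod_coe_sort a (fun e => if e ∈ T then 1 - (p e : ℝ) else (p e : ℝ))]
      refine Finset.prod_congr rfl fun x _ => ?_
      have hx : ((x : ι) ∈ T) ↔ x ∈ S := by rw [hT]; exact Finset.mem_map' _
      by_cases hxS : x ∈ S
      · rw [if_pos hxS, if_pos (hx.2 hxS)]
      · rw [if_neg hxS, if_neg (fun h => hxS (hx.1 h))]
    rw [h1, Finset.prod_ite, Finset.filter_mem_eq_inter, Finset.inter_eq_right.2 hsub, Finset.filter_not,
      Finset.filter_mem_eq_inter, Finset.inter_eq_right.2 hsub]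

end Box

/-! ## The main theorem -/

/-- Probability of the core: `μ(A) = (∏_h p)·(P_a + P_b − P_a P_b)`. [this work] -/
theorem real_core [Fintype ι] (p : ι → unitInterval) (g₁ g₂ : Finset ι) :
    (prodBernoulli p).real (core g₁ g₂) =
      (∏ e ∈ g₁ ∩ g₂, (p e : ℝ)) * ((∏ e ∈ g₁ \ g₂, (p e : ℝ)) + (∏ e ∈ g₂ \ g₁, (p e : ℝ)) -
        (∏ e ∈ g₁ \ g₂, (p e : ℝ)) * ∏ e ∈ g₂ \ g₁, (p e : ℝ)) := by
  classical
  have hU := measureReal_union_add_inter (μ := prodBernoulli p) (s := {ω : Set ι | (g₁ : Set ι) ⊆ ω})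
    (t := {ω : Set ι | (g₂ : Set ι) ⊆ ω}) MeasurableSet.of_discrete
  have hint : {ω : Set ι | (g₁ : Set ι) ⊆ ω} ∩ {ω : Set ι | (g₂ : Set ι) ⊆ ω} = {ω | ((g₁ ∪ g₂ : Finset ι) : Set ι) ⊆ ω} := by
    ext ω; simp [Set.union_subset_iff]
  rw [hint, prodBernoulli_real_subset, prodBernoulli_real_subset, prodBernoulli_real_subset] at hU
  change (prodBernoulli p).real ({ω : Set ι | (g₁ : Set ι) ⊆ ω} ∪ {ω : Set ι | (g₂ : Set ι) ⊆ ω}) = _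
  have hd2 : Disjoint (g₁ \ g₂) (g₂ \ g₁) := by
    rw [Finset.disjoint_left]; intro e he he'
    exact (Finset.mem_sdiff.1 he').2 (Finset.mem_sdiff.1 he).1
  have e1 : ∏ i ∈ g₁, ((p i : unitInterval) : ℝ) = (∏ e ∈ g₁ ∩ g₂, (p e : ℝ)) * ∏ e ∈ g₁ \ g₂, (p e : ℝ) := by
    rw [← Finset.prod_sdiff Finset.inter_subset_left, Finset.sdiff_inter_self_left, mul_comm]
  have e2 : ∏ i ∈ g₂, ((p i : unitInterval) : ℝ) = (∏ e ∈ g₁ ∩ g₂, (p e : ℝ)) * ∏ e ∈ g₂ \ g₁, (p e : ℝ) := by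
    rw [← Finset.prod_sdiff Finset.inter_subset_right, Finset.sdiff_inter_self_right, mul_comm]
  have e3 : ∏ i ∈ g₁ ∪ g₂, ((p i : unitInterval) : ℝ) =
      (∏ e ∈ g₁ ∩ g₂, (p e : ℝ)) * ((∏ e ∈ g₁ \ g₂, (p e : ℝ)) * ∏ e ∈ g₂ \ g₁, (p e : ℝ)) := by
    have hsub : g₁ ∩ g₂ ⊆ g₁ ∪ g₂ := Finset.inter_subset_left.trans Finset.subset_union_left
    have hsd : (g₁ ∪ g₂) \ (g₁ ∩ g₂) = g₁ \ g₂ ∪ g₂ \ g₁ := by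
      ext e; simp only [Finset.mem_sdiff, Finset.mem_union, Finset.mem_inter]; tauto
    rw [← Finset.prod_sdiff hsub, hsd, Finset.prod_union hd2, mul_comm]
  rw [e1, e2, e3] at hU
  linarith

/-- **TWO-GENERATOR-CORE THEOREM** (memo §3–§4).  For `μ = prodBernoulli p` on a finite cube and up-sets `V i` whose pairwise
intersections lie in `A = {g₁ ⊆ ω} ∪ {g₂ ⊆ ω}`:  `∏_i μ(V i) ≤ μ(A)^(|κ| − 1)`, for every `p`. [this work] -/
theorem prod_real_le_real_core_pow [Fintype ι] (p : ι → unitInterval) (g₁ g₂ : Finset ι) {V : κ → Set (Set ι)}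
    (hV : ∀ i, IsUpperSet (V i)) (hcap : ∀ i j, i ≠ j → V i ∩ V j ⊆ core g₁ g₂) :
    ∏ i, (prodBernoulli p).real (V i) ≤ ((prodBernoulli p).real (core g₁ g₂)) ^ (Fintype.card κ - 1) := by
  classical
  set h := g₁ ∩ g₂ with hh
  set a := g₁ \ g₂ with ha
  set b := g₂ \ g₁ with hb
  set K := Fintype.card κ with hK
  have hq : ∀ e, 0 ≤ ((p e : unitInterval) : ℝ) ∧ ((p e : unitInterval) : ℝ) ≤ 1 := fun e => ⟨(p e).2.1, (p e).2.2⟩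
  set Ph := ∏ e ∈ h, (p e : ℝ)
  set Pa := ∏ e ∈ a, (p e : ℝ)
  set Pb := ∏ e ∈ b, (p e : ℝ)
  have hPa : 0 ≤ Pa ∧ Pa ≤ 1 := ⟨Finset.prod_nonneg fun e _ => (hq e).1, Finset.prod_le_one (fun e _ => (hq e).1) fun e _ => (hq e).2⟩
  have hPb : 0 ≤ Pb ∧ Pb ≤ 1 := ⟨Finset.prod_nonneg fun e _ => (hq e).1, Finset.prod_le_one (fun e _ => (hq e).1) fun e _ => (hq e).2⟩
  have hPh : 0 ≤ Ph := Finset.prod_nonneg fun e _ => (hq e).1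
  -- supports and their disjointness
  let Uh : κ → Finset ι := fun i => suppH g₁ g₂ (V i)
  let Ub : κ → Finset (ι × ι) := fun i => suppB g₁ g₂ (V i)
  have hUh : ∀ i j, i ≠ j → Disjoint (Uh i) (Uh j) := fun i j hij => disjoint_suppH (hV i) (hV j) (hcap i j hij)
  have hUb : ∀ i j, i ≠ j → Disjoint (Ub i) (Ub j) := fun i j hij => disjoint_suppB (hV i) (hV j) (hcap i j hij)
  -- step 1–2: `μ(V i) ≤ kernel factor × box factor`
  let KER : κ → ℝ := fun i => ∏ e ∈ h \ Uh i, (p e : ℝ)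
  let BOX : κ → ℝ := fun i => ∑ T ∈ a.powerset, wmiss p a T * zeta p g₁ g₂ (col g₁ g₂ (Ub i) T)
  have hKER : ∀ i, 0 ≤ KER i := fun i => Finset.prod_nonneg fun e _ => (hq e).1
  have hwm : ∀ T, 0 ≤ wmiss p a T := fun T =>
    mul_nonneg (Finset.prod_nonneg fun e _ => by linarith [(hq e).2]) (Finset.prod_nonneg fun e _ => (hq e).1)
  have hBOX : ∀ i, 0 ≤ BOX i := fun i => Finset.sum_nonneg fun T _ =>
    mul_nonneg (hwm T) (Finset.prod_nonneg fun e _ => (hq e).1)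
  have hVi : ∀ i, (prodBernoulli p).real (V i) ≤ KER i * BOX i := by
    intro i
    calc (prodBernoulli p).real (V i) ≤ (prodBernoulli p).real (Zset g₁ g₂ (Uh i) (Ub i)) :=
          measureReal_mono (subset_Zset g₁ g₂ (V i))
      _ = KER i * BOX i := real_Zset p g₁ g₂ (Uh i) (Ub i)
  -- step 4: kernel factors
  have hker : ∏ i, KER i ≤ Ph ^ (K - 1) := prod_prod_sdiff_le_pow h hq Uh hUh
  -- step 5: box factors
  have hbox : ∏ i, BOX i ≤ (Pa + (1 - Pa) * Pb) ^ (K - 1) := by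
    rcases eq_or_lt_of_le hPb.1 with hPb0 | hPb0
    · -- degenerate case `∏_b p = 0`: some `p f₀ = 0`
      obtain ⟨f₀, hf₀b, hf₀⟩ := Finset.prod_eq_zero_iff.1 hPb0.symm
      let W : κ → Finset ι := fun i => a.filter fun e => (e, f₀) ∈ Ub i
      have hWd : ∀ i j, i ≠ j → Disjoint (W i) (W j) := by
        intro i j hij
        rw [Finset.disjoint_left]
        intro e hei hej
        exact Finset.disjoint_left.1 (hUb i j hij) (Finset.mem_filter.1 hei).2 (Finset.mem_filter.1 hej).2
      have hBOXle : ∀ i, BOX i ≤ ∏ e ∈ a \ W i, (p e : ℝ) := by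
        intro i
        have hWa : W i ⊆ a := Finset.filter_subset _ _
        -- off `(W i).powerset` the terms vanish: some `e ∈ T` has `(e,f₀) ∉ Ub i`, so `f₀ ∉ col`, so the factor `p f₀ = 0` appears in `ζ`
        have hvan : ∀ T ∈ a.powerset, T ∉ (W i).powerset → wmiss p a T * zeta p g₁ g₂ (col g₁ g₂ (Ub i) T) = 0 := by
          intro T hT hTW
          rw [Finset.mem_powerset] at hT hTW
          have hf₀c : f₀ ∉ col g₁ g₂ (Ub i) T := by
            intro hc
            apply hTW
            intro e he
            exact Finset.mem_filter.2 ⟨hT he, (mem_col.1 hc).2 e he⟩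
          have : zeta p g₁ g₂ (col g₁ g₂ (Ub i) T) = 0 :=
            Finset.prod_eq_zero (Finset.mem_sdiff.2 ⟨hf₀b, hf₀c⟩) hf₀
          rw [this, mul_zero]
        calc BOX i = ∑ T ∈ (W i).powerset, wmiss p a T * zeta p g₁ g₂ (col g₁ g₂ (Ub i) T) :=
              (Finset.sum_subset (Finset.powerset_mono.2 hWa) hvan).symm
          _ ≤ ∑ T ∈ (W i).powerset, wmiss p a T :=
              Finset.sum_le_sum fun T _ => mul_le_of_le_one_right (hwm T) (zeta_bounds p g₁ g₂ _).2
          _ = ∏ e ∈ a \ W i, (p e : ℝ) := sum_wmiss_subset p hWa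
      calc ∏ i, BOX i ≤ ∏ i, ∏ e ∈ a \ W i, (p e : ℝ) := Finset.prod_le_prod (fun i _ => hBOX i) fun i _ => hBOXle i
        _ ≤ Pa ^ (K - 1) := prod_prod_sdiff_le_pow a hq W hWd
        _ = (Pa + (1 - Pa) * Pb) ^ (K - 1) := by rw [← hPb0]; ring
    · -- `∏_b p > 0`: the K-decreasing-functions lemma on the subtype of `a`
      let emb := Function.Embedding.subtype (· ∈ a)
      let G : κ → Finset ↥a → ℝ := fun i S => zeta p g₁ g₂ (col g₁ g₂ (Ub i) (S.map emb))
      have hq' : ∀ x : ↥a, 0 ≤ ((p x : unitInterval) : ℝ) ∧ ((p x : unitInterval) : ℝ) ≤ 1 := fun x => hq x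
      have key := KDecreasing.prod_Ex_le_of_antitone' (g := ↥a) (Finset.univ : Finset κ) hq' hPb0 hPb.2 G
        (fun i _ S T hST => zeta_col_anti p g₁ g₂ (Ub i) (Finset.map_subset_map.2 hST))
        (fun i _ S => (zeta_bounds p g₁ g₂ _).1) (fun i _ S => (zeta_bounds p g₁ g₂ _).2) ?_
      · have hP1 : ∏ x : ↥a, ((p x : unitInterval) : ℝ) = Pa := Finset.prod_coe_sort a (fun e => ((p e : unitInterval) : ℝ))
        rw [hP1, Finset.card_univ] at key
        calc ∏ i, BOX i = ∏ i, KDecreasing.Ex (g := ↥a) (fun x => (p x : ℝ)) (G i) :=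
              Finset.prod_congr rfl fun i _ => box_eq_Ex p g₁ g₂ (Ub i)
          _ ≤ (Pa + (1 - Pa) * Pb) ^ (K - 1) := key
      · -- products at a nonempty row set: the columns are disjoint
        intro S hS
        obtain ⟨x, hx⟩ := hS
        have hcol : ∀ i j, i ≠ j → Disjoint (col g₁ g₂ (Ub i) (S.map emb)) (col g₁ g₂ (Ub j) (S.map emb)) := by
          intro i j hij
          rw [Finset.disjoint_left]
          intro f hfi hfj
          have hxi := (mem_col.1 hfi).2 x (Finset.mem_map_of_mem _ hx)
          have hxj := (mem_col.1 hfj).2 x (Finset.mem_map_of_mem _ hx)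
          exact Finset.disjoint_left.1 (hUb i j hij) hxi hxj
        rw [Finset.card_univ]
        exact prod_prod_sdiff_le_pow b hq _ hcol
  -- assembly
  have hcore : (prodBernoulli p).real (core g₁ g₂) = Ph * (Pa + (1 - Pa) * Pb) := by
    rw [real_core]; ring
  calc ∏ i, (prodBernoulli p).real (V i) ≤ ∏ i, KER i * BOX i :=
        Finset.prod_le_prod (fun i _ => measureReal_nonneg) fun i _ => hVi i
    _ = (∏ i, KER i) * ∏ i, BOX i := Finset.prod_mul_distrib
    _ ≤ Ph ^ (K - 1) * (Pa + (1 - Pa) * Pb) ^ (K - 1) :=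
        mul_le_mul hker hbox (Finset.prod_nonneg fun i _ => hBOX i) (pow_nonneg hPh _)
    _ = ((prodBernoulli p).real (core g₁ g₂)) ^ (K - 1) := by rw [hcore, mul_pow]

/-! ## Three-petal sunflowers with a two-generator core: Lemma A and the law-level rows, unconditionally -/

section Corollaries

variable [Fintype ι] (p : ι → unitInterval) (g₁ g₂ : Finset ι)

/-- **Lemma A for two-generator cores**: `μ(E₁) μ(E₂) μ(E₃) ≤ μ(A)²` for every three-petal sunflower of up-sets whose core is
`{g₁ ⊆ ω} ∪ {g₂ ⊆ ω}`, for every product measure. [this work] -/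
theorem lemmaA_of_twoGeneratorCore {E₁ E₂ E₃ A : Set (Set ι)} (h₁ : IsUpperSet E₁) (h₂ : IsUpperSet E₂) (h₃ : IsUpperSet E₃)
    (h12 : E₁ ∩ E₂ = A) (h13 : E₁ ∩ E₃ = A) (h23 : E₂ ∩ E₃ = A) (hA : A = core g₁ g₂) :
    (prodBernoulli p).real E₁ * (prodBernoulli p).real E₂ * (prodBernoulli p).real E₃ ≤ ((prodBernoulli p).real A) ^ 2 := by
  let V : Fin 3 → Set (Set ι) := ![E₁, E₂, E₃]
  have hV : ∀ i, IsUpperSet (V i) := by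
    intro i; fin_cases i
    · exact h₁
    · exact h₂
    · exact h₃
  have hcap : ∀ i j, i ≠ j → V i ∩ V j ⊆ core g₁ g₂ := by
    intro i j hij
    rw [← hA]
    fin_cases i <;> fin_cases j
    all_goals first
      | exact (hij rfl).elim
      | (change E₁ ∩ E₂ ⊆ A; exact h12.le)
      | (change E₂ ∩ E₁ ⊆ A; rw [Set.inter_comm]; exact h12.le)
      | (change E₁ ∩ E₃ ⊆ A; exact h13.le)
      | (change E₃ ∩ E₁ ⊆ A; rw [Set.inter_comm]; exact h13.le)
      | (change E₂ ∩ E₃ ⊆ A; exact h23.le)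
      | (change E₃ ∩ E₂ ⊆ A; rw [Set.inter_comm]; exact h23.le)
  have key := prod_real_le_real_core_pow p g₁ g₂ hV hcap
  rw [Fin.prod_univ_three, ← hA] at key
  simp only [V, Matrix.cons_val_zero, Matrix.cons_val_one, Matrix.cons_val, Fintype.card_fin] at key
  calc (prodBernoulli p).real E₁ * (prodBernoulli p).real E₂ * (prodBernoulli p).real E₃
      ≤ ((prodBernoulli p).real A) ^ (3 - 1) := key
    _ = ((prodBernoulli p).real A) ^ 2 := by norm_num

/-- **Lemma A in cells** (`c₁c₂c₃ ≤ a(ab − e₂)`) for two-generator cores. [this work] -/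
theorem e3_le_core_mul_AG₂ {E₁ E₂ E₃ A : Set (Set ι)} (h₁ : IsUpperSet E₁) (h₂ : IsUpperSet E₂) (h₃ : IsUpperSet E₃)
    (h12 : E₁ ∩ E₂ = A) (h13 : E₁ ∩ E₃ = A) (h23 : E₂ ∩ E₃ = A) (hA : A = core g₁ g₂) :
    (prodBernoulli p).real (E₁ \ A) * (prodBernoulli p).real (E₂ \ A) * (prodBernoulli p).real (E₃ \ A) ≤
      (prodBernoulli p).real A * ((prodBernoulli p).real A * (prodBernoulli p).real (E₁ ∪ E₂ ∪ E₃)ᶜ -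
        ((prodBernoulli p).real (E₁ \ A) * (prodBernoulli p).real (E₂ \ A) +
          (prodBernoulli p).real (E₁ \ A) * (prodBernoulli p).real (E₃ \ A) +
          (prodBernoulli p).real (E₂ \ A) * (prodBernoulli p).real (E₃ \ A))) := by
  have key := lemmaA_of_twoGeneratorCore p g₁ g₂ h₁ h₂ h₃ h12 h13 h23 hA
  obtain ⟨e₁, e₂, e₃, eB⟩ := PrincipalCore.cells_eq p h12 h13 h23
  rw [e₁, e₂, e₃] at key
  rw [eB]
  nlinarith [key]

/-- **(C1-law) for two-generator cores**: `e₃ ≤ max(a,b)·(ab − e₂)`, unconditionally. [this work] -/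
theorem e3_le_max_mul_AG₂ {E₁ E₂ E₃ A : Set (Set ι)} (h₁ : IsUpperSet E₁) (h₂ : IsUpperSet E₂) (h₃ : IsUpperSet E₃)
    (h12 : E₁ ∩ E₂ = A) (h13 : E₁ ∩ E₃ = A) (h23 : E₂ ∩ E₃ = A) (hA : A = core g₁ g₂) :
    (prodBernoulli p).real (E₁ \ A) * (prodBernoulli p).real (E₂ \ A) * (prodBernoulli p).real (E₃ \ A) ≤
      max ((prodBernoulli p).real A) ((prodBernoulli p).real (E₁ ∪ E₂ ∪ E₃)ᶜ) *
        ((prodBernoulli p).real A * (prodBernoulli p).real (E₁ ∪ E₂ ∪ E₃)ᶜ -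
          ((prodBernoulli p).real (E₁ \ A) * (prodBernoulli p).real (E₂ \ A) +
            (prodBernoulli p).real (E₁ \ A) * (prodBernoulli p).real (E₃ \ A) +
            (prodBernoulli p).real (E₂ \ A) * (prodBernoulli p).real (E₃ \ A))) := by
  have hLA := e3_le_core_mul_AG₂ p g₁ g₂ h₁ h₂ h₃ h12 h13 h23 hA
  have hAG := prodBernoulli_strongHarris_sunflower_three p h₁ h₂ h₃ h12 h13 h23
  have hmax : (prodBernoulli p).real A ≤ max ((prodBernoulli p).real A) ((prodBernoulli p).real (E₁ ∪ E₂ ∪ E₃)ᶜ) :=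
    le_max_left _ _
  nlinarith [hmax, hAG, hLA]

/-- **The `H`-row** `(a+b)(ab − e₂) ≥ e₃` for two-generator cores, unconditionally. [this work] -/
theorem lawH_nonneg₂ {E₁ E₂ E₃ A : Set (Set ι)} (h₁ : IsUpperSet E₁) (h₂ : IsUpperSet E₂) (h₃ : IsUpperSet E₃)
    (h12 : E₁ ∩ E₂ = A) (h13 : E₁ ∩ E₃ = A) (h23 : E₂ ∩ E₃ = A) (hA : A = core g₁ g₂) :
    0 ≤ ((prodBernoulli p).real A + (prodBernoulli p).real (E₁ ∪ E₂ ∪ E₃)ᶜ) *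
        ((prodBernoulli p).real A * (prodBernoulli p).real (E₁ ∪ E₂ ∪ E₃)ᶜ -
          ((prodBernoulli p).real (E₁ \ A) * (prodBernoulli p).real (E₂ \ A) +
            (prodBernoulli p).real (E₁ \ A) * (prodBernoulli p).real (E₃ \ A) +
            (prodBernoulli p).real (E₂ \ A) * (prodBernoulli p).real (E₃ \ A))) -
      (prodBernoulli p).real (E₁ \ A) * (prodBernoulli p).real (E₂ \ A) * (prodBernoulli p).real (E₃ \ A) := by
  have hLA := e3_le_core_mul_AG₂ p g₁ g₂ h₁ h₂ h₃ h12 h13 h23 hA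
  have hAG := prodBernoulli_strongHarris_sunflower_three p h₁ h₂ h₃ h12 h13 h23
  have hb : 0 ≤ (prodBernoulli p).real (E₁ ∪ E₂ ∪ E₃)ᶜ := measureReal_nonneg
  nlinarith [hb, hAG, hLA]

/-- **Kahn's Conjecture 5 / Sahi `E₃ ≥ 0` for the complements of a sunflower of up-sets with a two-generator core**, unconditionally. [this work] -/
theorem sahiE3_compl_nonneg_of_twoGeneratorCore {E₁ E₂ E₃ A : Set (Set ι)} (h₁ : IsUpperSet E₁) (h₂ : IsUpperSet E₂)
    (h₃ : IsUpperSet E₃) (h12 : E₁ ∩ E₂ = A) (h13 : E₁ ∩ E₃ = A) (h23 : E₂ ∩ E₃ = A) (hA : A = core g₁ g₂) :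
    0 ≤ sahiE3 (prodBernoulli p) E₁ᶜ E₂ᶜ E₃ᶜ := by
  classical
  have m₁ : MeasurableSet E₁ := MeasurableSet.of_discrete
  have m₂ : MeasurableSet E₂ := MeasurableSet.of_discrete
  have m₃ : MeasurableSet E₃ := MeasurableSet.of_discrete
  rw [sahiE3_compl_sunflower_eq (prodBernoulli p) m₁ m₂ m₃ h12 h13 h23]
  have hLA := e3_le_core_mul_AG₂ p g₁ g₂ h₁ h₂ h₃ h12 h13 h23 hA
  have hAG := prodBernoulli_strongHarris_sunflower_three p h₁ h₂ h₃ h12 h13 h23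
  have ha0 : 0 ≤ (prodBernoulli p).real A := measureReal_nonneg
  nlinarith [ha0, hAG, hLA]

end Corollaries

end TwoGenCore

end Summit.CriticalPhenomena.PercolationContinuityZ3.Theorems.SunflowerPartition
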